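import Summits.ResolutionOfSingularities.ResolutionOfSingularities.Theorems.WeightedInvariantELadderOneDisjoint
import Summits.ResolutionOfSingularities.ResolutionOfSingularities.Theorems.WeightedInvariantRegularWeightedCentreProduct
import HarnessLib

/-!
# Rung `e = 1` of the door: the product of the orbit-wise centres is admissible with support `singImage`

Route `ResolutionOfSingularities/WeightedInvariant`, door crux `HypersurfaceCentreConstruction`
(stmt-ResolutionOfSingularities-19897) — OURS, helper; e-ladder `e = 1`, registered stub `stub_e1_centre` of
`res-L1-w43-stub-10` (cell res-hironaka, `D/res-D-pv-025/DOOR-ELADDER-PLAN.md` §7, sub-lemma **L2′** «support»).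
Companion of `Theorems/WeightedInvariantELadderOneDisjoint.lean` (the orbit closures `closure {η}` of the
maximal singular points `η ∈ maxSing` are pairwise disjoint under `Stage.Inv`), which it imports and does not
restate.

The centre of rung `e = 1` is the product, over the finitely many maximal points `η` of the image `singImage`
of the non-regular locus (`Stage.maxSing`, `Stage.maxSing_finite`), of orbit-wise admissible centres `R η`
supported on `closure {η}` (the germ contraction of the Abramovich–Quek–Schober chart at `η`,
`support_ofGermFiltration_weightedMonomialIdeal`).  This file assembles the two global clauses of
`stub_e1_centre` from such orbit-wise data:

* §1 `Stage.singImage_eq_biUnion_closure`: `singImage = ⋃ η ∈ maxSing, closure {η}` (every singular image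
  point specialises from a maximal one, `exists_mem_maxSing_of_mem_singImage`; `singImage` is closed);
* §2 an `Inv′`-ready form of the disjointness of the orbit closures: every singular image point lies in a chart
  of the atlas carrying homogeneous units of all degrees in `e • ℤʲ` on `X` (`exists_unitChart_of_mem_singImage`,
  from `GradedAtlas.exists_unit`), and distinct maximal singular points have disjoint closures as soon as the
  orbit condition (I2) («`𝔭_η` homogeneous with graded-simple quotient») holds on ONE chart through each point
  of `singImage` (`disjoint_closure_of_orbitCharts`), in particular as soon as it holds on the unit charts
  (`disjoint_closure_of_unitCharts`) — the same argument as `disjoint_closure_of_mem_maxSing` (which asks (I2) on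
  every chart, i.e. `Stage.Inv` as typed), recorded for the weakened invariant under discussion for
  `stub_e1_inv_succ`;
* §3 the PRODUCT CENTRE: a Rees algebra with pieces `∏_{η ∈ maxSing} (R η)ₙ` exists
  (`exists_reesAlgebraData_piece_eq_finsetProd`, def-free packaging), and for orbit-wise admissible centres
  `R η` with `(R η).support = closure {η}` and pairwise disjoint orbit closures every such Rees algebra is an
  admissible centre with support `singImage` (`isAdmissibleCentre_and_support_eq_singImage_of_piece_eq_finsetProd`,
  via `isAdmissibleCentre_of_piece_eq_finsetProd`); under `Stage.Inv` the disjointness is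
  `pairwiseDisjoint_closure_maxSing` (`…_of_inv`, `exists_isAdmissibleCentre_support_eq_singImage_of_inv`);
* §4 LOCALITY and the packaged form the stub owner asked for (res-D-pv-025, STATUS 2026-08-27T08:22:30Z (3)):
  on an affine open missing the other orbit closures the product centre has the sections of `R η`
  (`ideal_piece_eq_of_forall_disjoint`, from `ideal_piece_eq_top_of_forall_not_mem_support` and
  `ideal_finsetProd`), and from orbit-wise EXISTENCE statements carrying an arbitrary rider `Q η R` (the drop
  clause over `η`) one gets a choice `R η`, the product `P`, admissibility, `support = singImage` and the
  locality, in one `∃` (`exists_isAdmissibleCentre_support_eq_singImage_of_forall_exists`, `…_of_inv_…`,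
  `…_of_unitCharts_…`).

Def-free; no named facts; nothing here is a claim about Hironaka's problem and no statement of H. Hironaka's
manuscript is used.  AI-written; weaker than expert review.
-/

noncomputable section

set_option linter.dupNamespace false -- mandated namespace of this single-conjunct summit

open CategoryTheory AlgebraicGeometry TopologicalSpace IsLocalRing
open Literature.AlgebraicGeometry.Resolution

namespace Summit.ResolutionOfSingularities.ResolutionOfSingularities.Theorems

universe u

/-! ## Two chart sentences -/

section Charts

variable {Y : Scheme.{u}}

/-- A point of an open set lying in the closure of `η` forces `η` into the open set. [folklore] -/
theorem mem_opens_of_mem_closure_singleton {V : Y.Opens} {η y : Y} (h : y ∈ closure ({η} : Set Y))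
    (hy : y ∈ V) : η ∈ V := by
  obtain ⟨z, hzV, hz⟩ := mem_closure_iff.mp h V V.isOpen hy
  rw [Set.mem_singleton_iff] at hz
  exact hz ▸ hzV

variable (W : Y.affineOpens) {ι : Type*} [DecidableEq ι] [AddMonoid ι] (𝒜 : ι → AddSubgroup Γ(Y, W))
  [GradedRing 𝒜]

/-- **Two orbit primes under a common point.**  Let `W` be an affine open of `Y` with a grading `𝒜` of
`Γ(Y, W)` and `η, η', y ∈ W` with `y ∈ closure {η} ∩ closure {η'}`.  If `𝔭_η` has graded-simple quotient
(every homogeneous section off `𝔭_η` is a unit modulo `𝔭_η`) and `𝔭_{η'}` is homogeneous, then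
`η ∈ closure {η'}`: both primes lie under the proper prime `𝔭_y`, so `𝔭_{η'} ≤ 𝔭_η`
(`le_of_isHomogeneous_of_gradedSimple`), read back on points (`mem_closure_of_primeIdealOf_le`). [folklore] -/
theorem mem_closure_of_gradedSimple_of_mem_closure {η η' y : Y} (hη : η ∈ (W : Y.Opens))
    (hη' : η' ∈ (W : Y.Opens)) (hy : y ∈ (W : Y.Opens))
    (hsimple : ∀ (d : ι) (x : Γ(Y, W)), x ∈ 𝒜 d → x ∉ (W.2.primeIdealOf ⟨η, hη⟩).asIdeal →
      IsUnit (Ideal.Quotient.mk (W.2.primeIdealOf ⟨η, hη⟩).asIdeal x))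
    (hhom' : ((W.2.primeIdealOf ⟨η', hη'⟩).asIdeal).IsHomogeneous 𝒜)
    (hyη : y ∈ closure ({η} : Set Y)) (hyη' : y ∈ closure ({η'} : Set Y)) :
    η ∈ closure ({η'} : Set Y) :=
  mem_closure_of_primeIdealOf_le W hη' hη
    (le_of_isHomogeneous_of_gradedSimple 𝒜 hhom' hsimple (primeIdealOf_le_of_mem_closure W hη hy hyη)
      (primeIdealOf_le_of_mem_closure W hη' hy hyη') (W.2.primeIdealOf ⟨y, hy⟩).2.ne_top)

end Charts

/-! ## Finite products of Rees algebras exist (def-free packaging); their sections off the other supports -/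

/-- **A Rees algebra with prescribed product pieces exists**: for a finite family `R i` there is a Rees
algebra `P` on `Y` with `Pₙ = ∏_{i ∈ s} (R i)ₙ` (`P₀ = 𝒪_Y`, `Pₘ·Pₙ ≤ P_{m+n}` factorwise). [folklore] -/
theorem exists_reesAlgebraData_piece_eq_finsetProd {Y : Scheme.{u}} {ι : Type*} (s : Finset ι)
    (R : ι → ReesAlgebraData Y) :
    ∃ P : ReesAlgebraData Y, ∀ n, P.piece n = ∏ i ∈ s, (R i).piece n :=
  ⟨{ piece := fun n => ∏ i ∈ s, (R i).piece n
     piece_zero := by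
       rw [Finset.prod_eq_one fun i _ => (R i).piece_zero]
       rfl
     piece_mul_le := fun m n => by
       rw [← Finset.prod_mul_distrib]
       exact Finset.prod_le_prod' fun i _ => (R i).piece_mul_le m n },
    fun _ => rfl⟩

/-- Sections of a finite product of ideal sheaves on an affine open are the product of the sections
(`Scheme.IdealSheafData.ideal_mul`, iterated). [folklore] -/
theorem ideal_finsetProd {Y : Scheme.{u}} {ι : Type*} (s : Finset ι) (I : ι → Y.IdealSheafData)
    (U : Y.affineOpens) : (∏ i ∈ s, I i).ideal U = ∏ i ∈ s, (I i).ideal U := by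
  classical
  induction s using Finset.induction_on with
  | empty =>
    rw [Finset.prod_empty, Finset.prod_empty, Ideal.one_eq_top, Scheme.IdealSheafData.one_eq_top]
    rfl
  | insert a s ha ih =>
    rw [Finset.prod_insert ha, Finset.prod_insert ha, Scheme.IdealSheafData.ideal_mul, Pi.mul_apply, ih]

/-- **Locality of a product of regular weighted centres**: on an affine open `U` missing the supports of all
factors but `R a`, the sections of the product pieces are those of `R a` (the other factors have unit sections
there, `ideal_piece_eq_top_of_forall_not_mem_support`). [folklore] -/
theorem ideal_piece_eq_of_piece_eq_finsetProd {Y : Scheme.{u}} {ι : Type*} (s : Finset ι)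
    (R : ι → ReesAlgebraData Y) (hreg : ∀ i ∈ s, (R i).IsRegularWeightedCentre)
    (P : ReesAlgebraData Y) (hP : ∀ n, P.piece n = ∏ i ∈ s, (R i).piece n)
    {a : ι} (ha : a ∈ s) (U : Y.affineOpens)
    (hU : ∀ i ∈ s, i ≠ a → ∀ y ∈ (U : Y.Opens), y ∉ (R i).support) (n : ℕ) :
    (P.piece n).ideal U = ((R a).piece n).ideal U := by
  rw [hP n, ideal_finsetProd]
  refine Finset.prod_eq_single a (fun i hi hia => ?_) (fun h => absurd ha h)
  rw [Ideal.one_eq_top]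
  exact ideal_piece_eq_top_of_forall_not_mem_support (hreg i hi) U (hU i hi hia) n

namespace ELadderOne.Stage

variable {k : Type} [Field k] (S : Stage k)

/-! ## §1 `singImage` is the union of the orbit closures of its maximal points -/

/-- **`singImage = ⋃_{η ∈ maxSing} closure {η}`**: every singular image point specialises from a maximal one
(`exists_mem_maxSing_of_mem_singImage`), and `singImage` is closed (`closure_subset_singImage`). [folklore] -/
theorem singImage_eq_biUnion_closure :
    singImage S.i.ker = ⋃ η ∈ S.maxSing, closure ({η} : Set S.Y) := by
  apply subset_antisymm
  · intro y hy
    obtain ⟨η, hη, hyη⟩ := S.exists_mem_maxSing_of_mem_singImage hy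
    exact Set.mem_biUnion hη hyη
  · exact Set.iUnion₂_subset fun η hη => S.closure_subset_singImage (S.maxSing_subset_singImage hη)

/-! ## §2 Disjointness of the orbit closures from (I2) on one chart through each point -/

/-- **Every singular image point lies in a UNIT CHART of the atlas**: a chart `W a ∋ y` carrying homogeneous
sections of every degree in `e • ℤʲ` that are units on `X ∩ W a` (`GradedAtlas.exists_unit`; finite
stabilisers). [folklore] -/
theorem exists_unitChart_of_mem_singImage {y : S.Y} (hy : y ∈ singImage S.i.ker) :
    ∃ a : S.atlas.ι, y ∈ (S.atlas.W a : S.Y.Opens) ∧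
      ∀ χ : Fin S.j → ℤ, ∃ s ∈ S.atlas.piece a (S.atlas.exponent • χ), IsUnit (S.i.app (S.atlas.W a) s) := by
  obtain ⟨x, rfl⟩ := S.mem_range_of_mem_singImage hy
  exact S.atlas.exists_unit x

/-- **Disjointness of the orbit closures of distinct maximal singular points — chart-pointwise form.**
Suppose every point `y` of `singImage` lies in some chart `W a` of the atlas on which, for every maximal
singular point `η ∈ W a`, the prime `𝔭_η ⊆ Γ(Y, W a)` is homogeneous with graded-simple quotient (the orbit
condition (I2), asked only on ONE chart through each point).  Then distinct `η, η' ∈ maxSing` have disjoint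
closures: a common point `y` lies in such a chart, which then contains `η` and `η'`, and
`mem_closure_of_gradedSimple_of_mem_closure` gives `η ∈ closure {η'}`, against maximality of `η`
(`not_mem_closure_of_mem_maxSing`). [folklore] -/
theorem disjoint_closure_of_orbitCharts
    (horb : ∀ y ∈ singImage S.i.ker, ∃ (a : S.atlas.ι) (_ : y ∈ (S.atlas.W a : S.Y.Opens)),
      ∀ (η : S.Y) (_ : η ∈ S.maxSing) (hη : η ∈ (S.atlas.W a : S.Y.Opens)),
        letI := S.atlas.gradedRing a
        (((S.atlas.W a).2.primeIdealOf ⟨η, hη⟩).asIdeal).IsHomogeneous (S.atlas.piece a) ∧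
        ∀ (d : Fin S.j → ℤ) (x : Γ(S.Y, S.atlas.W a)), x ∈ S.atlas.piece a d →
          x ∉ ((S.atlas.W a).2.primeIdealOf ⟨η, hη⟩).asIdeal →
            IsUnit (Ideal.Quotient.mk ((S.atlas.W a).2.primeIdealOf ⟨η, hη⟩).asIdeal x))
    {η η' : S.Y} (hη : η ∈ S.maxSing) (hη' : η' ∈ S.maxSing) (hne : η ≠ η') :
    Disjoint (closure ({η} : Set S.Y)) (closure ({η'} : Set S.Y)) := by
  rw [Set.disjoint_left]
  intro y hyη hyη'
  have hy : y ∈ singImage S.i.ker := S.closure_subset_singImage (S.maxSing_subset_singImage hη) hyη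
  obtain ⟨a, hya, hI2⟩ := horb y hy
  have hηa : η ∈ (S.atlas.W a : S.Y.Opens) := mem_opens_of_mem_closure_singleton hyη hya
  have hη'a : η' ∈ (S.atlas.W a : S.Y.Opens) := mem_opens_of_mem_closure_singleton hyη' hya
  letI := S.atlas.gradedRing a
  obtain ⟨-, hsimple⟩ := hI2 η hη hηa
  obtain ⟨hhom', -⟩ := hI2 η' hη' hη'a
  exact S.not_mem_closure_of_mem_maxSing hη hη' hne
    (mem_closure_of_gradedSimple_of_mem_closure (S.atlas.W a) (S.atlas.piece a) hηa hη'a hya hsimple hhom'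
      hyη hyη')

/-- **Disjointness of the orbit closures under the UNIT-CHART form of (I2)**: it suffices that (I2) holds on
the charts carrying homogeneous units of all degrees in `e • ℤʲ` on `X` (such charts cover `X` by
`GradedAtlas.exists_unit`) — the weakening `(I2w)` of the invariant; compare `disjoint_closure_of_mem_maxSing`
(all charts, `Stage.Inv` as typed). [folklore] -/
theorem disjoint_closure_of_unitCharts
    (hI2w : ∀ a : S.atlas.ι,
      (∀ χ : Fin S.j → ℤ, ∃ s ∈ S.atlas.piece a (S.atlas.exponent • χ), IsUnit (S.i.app (S.atlas.W a) s)) →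
      ∀ (η : S.Y) (_ : η ∈ S.maxSing) (hη : η ∈ (S.atlas.W a : S.Y.Opens)),
        letI := S.atlas.gradedRing a
        (((S.atlas.W a).2.primeIdealOf ⟨η, hη⟩).asIdeal).IsHomogeneous (S.atlas.piece a) ∧
        ∀ (d : Fin S.j → ℤ) (x : Γ(S.Y, S.atlas.W a)), x ∈ S.atlas.piece a d →
          x ∉ ((S.atlas.W a).2.primeIdealOf ⟨η, hη⟩).asIdeal →
            IsUnit (Ideal.Quotient.mk ((S.atlas.W a).2.primeIdealOf ⟨η, hη⟩).asIdeal x))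
    {η η' : S.Y} (hη : η ∈ S.maxSing) (hη' : η' ∈ S.maxSing) (hne : η ≠ η') :
    Disjoint (closure ({η} : Set S.Y)) (closure ({η'} : Set S.Y)) :=
  S.disjoint_closure_of_orbitCharts (fun y hy => by
    obtain ⟨a, hya, hunit⟩ := S.exists_unitChart_of_mem_singImage hy
    exact ⟨a, hya, hI2w a hunit⟩) hη hη' hne

/-- Pairwise form of `disjoint_closure_of_unitCharts` over `maxSing` (the `hdisj` input of
`isAdmissibleCentre_of_piece_eq_finsetProd` under the unit-chart form of (I2)). [folklore] -/
theorem pairwiseDisjoint_closure_of_unitCharts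
    (hI2w : ∀ a : S.atlas.ι,
      (∀ χ : Fin S.j → ℤ, ∃ s ∈ S.atlas.piece a (S.atlas.exponent • χ), IsUnit (S.i.app (S.atlas.W a) s)) →
      ∀ (η : S.Y) (_ : η ∈ S.maxSing) (hη : η ∈ (S.atlas.W a : S.Y.Opens)),
        letI := S.atlas.gradedRing a
        (((S.atlas.W a).2.primeIdealOf ⟨η, hη⟩).asIdeal).IsHomogeneous (S.atlas.piece a) ∧
        ∀ (d : Fin S.j → ℤ) (x : Γ(S.Y, S.atlas.W a)), x ∈ S.atlas.piece a d →
          x ∉ ((S.atlas.W a).2.primeIdealOf ⟨η, hη⟩).asIdeal →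
            IsUnit (Ideal.Quotient.mk ((S.atlas.W a).2.primeIdealOf ⟨η, hη⟩).asIdeal x)) :
    S.maxSing.PairwiseDisjoint fun η => closure ({η} : Set S.Y) :=
  fun _ hη _ hη' hne => S.disjoint_closure_of_unitCharts hI2w hη hη' hne

/-! ## §3 The product of the orbit-wise centres is admissible with support `singImage` -/

/-- **The product centre.**  Let `R η` (`η ∈ maxSing`) be admissible centres for the pair `(S.f, ker S.i)`
with `(R η).support = closure {η}`, the orbit closures being pairwise disjoint.  Then every Rees algebra `P`
with pieces `Pₙ = ∏_{η ∈ maxSing} (R η)ₙ` is an admissible centre with `P.support = singImage (ker S.i)`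
(`isAdmissibleCentre_of_piece_eq_finsetProd` + `singImage_eq_biUnion_closure`). [folklore] -/
theorem isAdmissibleCentre_and_support_eq_singImage_of_piece_eq_finsetProd
    (R : S.Y → ReesAlgebraData S.Y) (hadm : ∀ η ∈ S.maxSing, IsAdmissibleCentre S.f S.i.ker (R η))
    (hsupp : ∀ η ∈ S.maxSing, (R η).support = closure ({η} : Set S.Y))
    (hdisj : S.maxSing.PairwiseDisjoint fun η => closure ({η} : Set S.Y))
    (P : ReesAlgebraData S.Y) (hP : ∀ n, P.piece n = ∏ η ∈ S.maxSing_finite.toFinset, (R η).piece n) :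
    IsAdmissibleCentre S.f S.i.ker P ∧ P.support = singImage S.i.ker := by
  have hmem : ∀ {η : S.Y}, η ∈ S.maxSing_finite.toFinset ↔ η ∈ S.maxSing := Set.Finite.mem_toFinset _
  obtain ⟨hadmP, hsuppP⟩ := isAdmissibleCentre_of_piece_eq_finsetProd S.f S.i.ker
    S.maxSing_finite.toFinset R (fun η hη => hadm η (hmem.mp hη))
    (fun η hη η' hη' hne => by
      rw [hsupp η (hmem.mp hη), hsupp η' (hmem.mp hη')]
      exact hdisj (hmem.mp hη) (hmem.mp hη') hne)
    P hP
  refine ⟨hadmP, ?_⟩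
  rw [hsuppP, S.singImage_eq_biUnion_closure]
  ext y
  simp only [Set.mem_iUnion, exists_prop]
  constructor
  · rintro ⟨η, hη, hy⟩
    exact ⟨η, hmem.mp hη, (hsupp η (hmem.mp hη)) ▸ hy⟩
  · rintro ⟨η, hη, hy⟩
    exact ⟨η, hmem.mpr hη, (hsupp η hη).symm ▸ hy⟩

/-- **The product centre under `Stage.Inv`** (disjointness supplied by `pairwiseDisjoint_closure_maxSing`).
[folklore] -/
theorem isAdmissibleCentre_and_support_eq_singImage_of_inv (hInv : S.Inv)
    (R : S.Y → ReesAlgebraData S.Y) (hadm : ∀ η ∈ S.maxSing, IsAdmissibleCentre S.f S.i.ker (R η))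
    (hsupp : ∀ η ∈ S.maxSing, (R η).support = closure ({η} : Set S.Y))
    (P : ReesAlgebraData S.Y) (hP : ∀ n, P.piece n = ∏ η ∈ S.maxSing_finite.toFinset, (R η).piece n) :
    IsAdmissibleCentre S.f S.i.ker P ∧ P.support = singImage S.i.ker :=
  S.isAdmissibleCentre_and_support_eq_singImage_of_piece_eq_finsetProd R hadm hsupp
    (S.pairwiseDisjoint_closure_maxSing hInv) P hP

/-- **Existence of the product centre under `Stage.Inv`**: orbit-wise admissible centres supported on the
orbit closures assemble to ONE admissible centre supported on the whole of `singImage`, whose pieces are the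
products of the orbit-wise pieces. [folklore] -/
theorem exists_isAdmissibleCentre_support_eq_singImage_of_inv (hInv : S.Inv)
    (R : S.Y → ReesAlgebraData S.Y) (hadm : ∀ η ∈ S.maxSing, IsAdmissibleCentre S.f S.i.ker (R η))
    (hsupp : ∀ η ∈ S.maxSing, (R η).support = closure ({η} : Set S.Y)) :
    ∃ P : ReesAlgebraData S.Y, (∀ n, P.piece n = ∏ η ∈ S.maxSing_finite.toFinset, (R η).piece n) ∧
      IsAdmissibleCentre S.f S.i.ker P ∧ P.support = singImage S.i.ker := by
  obtain ⟨P, hP⟩ := exists_reesAlgebraData_piece_eq_finsetProd S.maxSing_finite.toFinset R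
  exact ⟨P, hP, S.isAdmissibleCentre_and_support_eq_singImage_of_inv hInv R hadm hsupp P hP⟩

/-- **Existence of the product centre under the unit-chart form of (I2)** (for the weakened invariant).
[folklore] -/
theorem exists_isAdmissibleCentre_support_eq_singImage_of_unitCharts
    (hI2w : ∀ a : S.atlas.ι,
      (∀ χ : Fin S.j → ℤ, ∃ s ∈ S.atlas.piece a (S.atlas.exponent • χ), IsUnit (S.i.app (S.atlas.W a) s)) →
      ∀ (η : S.Y) (_ : η ∈ S.maxSing) (hη : η ∈ (S.atlas.W a : S.Y.Opens)),
        letI := S.atlas.gradedRing a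
        (((S.atlas.W a).2.primeIdealOf ⟨η, hη⟩).asIdeal).IsHomogeneous (S.atlas.piece a) ∧
        ∀ (d : Fin S.j → ℤ) (x : Γ(S.Y, S.atlas.W a)), x ∈ S.atlas.piece a d →
          x ∉ ((S.atlas.W a).2.primeIdealOf ⟨η, hη⟩).asIdeal →
            IsUnit (Ideal.Quotient.mk ((S.atlas.W a).2.primeIdealOf ⟨η, hη⟩).asIdeal x))
    (R : S.Y → ReesAlgebraData S.Y) (hadm : ∀ η ∈ S.maxSing, IsAdmissibleCentre S.f S.i.ker (R η))
    (hsupp : ∀ η ∈ S.maxSing, (R η).support = closure ({η} : Set S.Y)) :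
    ∃ P : ReesAlgebraData S.Y, (∀ n, P.piece n = ∏ η ∈ S.maxSing_finite.toFinset, (R η).piece n) ∧
      IsAdmissibleCentre S.f S.i.ker P ∧ P.support = singImage S.i.ker := by
  obtain ⟨P, hP⟩ := exists_reesAlgebraData_piece_eq_finsetProd S.maxSing_finite.toFinset R
  exact ⟨P, hP, S.isAdmissibleCentre_and_support_eq_singImage_of_piece_eq_finsetProd R hadm hsupp
    (S.pairwiseDisjoint_closure_of_unitCharts hI2w) P hP⟩

/-! ## §4 Locality of the product centre near one orbit, and the packaged existence statement -/

/-- **Near one orbit the product centre IS the orbit-wise centre.**  For orbit-wise regular weighted centres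
`R η` supported on `closure {η}` (`η ∈ maxSing`) and `P` with pieces `∏_η (R η)ₙ`: on every affine open `U`
missing the closures of the maximal singular points other than `η`, `(Pₙ)(U) = ((R η)ₙ)(U)` for all `n` — the
form the drop clause over `η` consumes (`P = R η` near `closure {η}`). [folklore] -/
theorem ideal_piece_eq_of_forall_disjoint (R : S.Y → ReesAlgebraData S.Y)
    (hreg : ∀ η ∈ S.maxSing, (R η).IsRegularWeightedCentre)
    (hsupp : ∀ η ∈ S.maxSing, (R η).support = closure ({η} : Set S.Y))
    (P : ReesAlgebraData S.Y) (hP : ∀ n, P.piece n = ∏ η ∈ S.maxSing_finite.toFinset, (R η).piece n)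
    {η : S.Y} (hη : η ∈ S.maxSing) (U : S.Y.affineOpens)
    (hU : ∀ η' ∈ S.maxSing, η' ≠ η → Disjoint ((U : S.Y.Opens) : Set S.Y) (closure ({η'} : Set S.Y)))
    (n : ℕ) : (P.piece n).ideal U = ((R η).piece n).ideal U := by
  have hmem : ∀ {η : S.Y}, η ∈ S.maxSing_finite.toFinset ↔ η ∈ S.maxSing := Set.Finite.mem_toFinset _
  refine ideal_piece_eq_of_piece_eq_finsetProd S.maxSing_finite.toFinset R
    (fun η' hη' => hreg η' (hmem.mp hη')) P hP (hmem.mpr hη) U (fun η' hη' hne y hy hyR => ?_) n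
  rw [hsupp η' (hmem.mp hη')] at hyR
  exact Set.disjoint_left.mp (hU η' (hmem.mp hη') hne) hy hyR

/-- **Packaged existence (orbit-wise data with a rider).**  Suppose the orbit closures of the maximal singular
points are pairwise disjoint and that at every `η ∈ maxSing` SOME admissible centre `R` with
`R.support = closure {η}` satisfying an arbitrary extra clause `Q η R` exists (the rider: e.g. the order drop
over `η` along the Rees filtrations of `R`).  Then there are a choice `R η` of such centres and a Rees algebra
`P` with pieces `∏_η (R η)ₙ` which is an admissible centre with `P.support = singImage`, and which agrees with
`R η` on every affine open missing the other orbit closures. [folklore] -/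
theorem exists_isAdmissibleCentre_support_eq_singImage_of_forall_exists
    (hdisj : S.maxSing.PairwiseDisjoint fun η => closure ({η} : Set S.Y))
    (Q : S.Y → ReesAlgebraData S.Y → Prop)
    (h : ∀ η ∈ S.maxSing, ∃ R : ReesAlgebraData S.Y,
      IsAdmissibleCentre S.f S.i.ker R ∧ R.support = closure ({η} : Set S.Y) ∧ Q η R) :
    ∃ (R : S.Y → ReesAlgebraData S.Y) (P : ReesAlgebraData S.Y),
      (∀ η ∈ S.maxSing,
        IsAdmissibleCentre S.f S.i.ker (R η) ∧ (R η).support = closure ({η} : Set S.Y) ∧ Q η (R η)) ∧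
      (∀ n, P.piece n = ∏ η ∈ S.maxSing_finite.toFinset, (R η).piece n) ∧
      IsAdmissibleCentre S.f S.i.ker P ∧ P.support = singImage S.i.ker ∧
      ∀ η ∈ S.maxSing, ∀ U : S.Y.affineOpens,
        (∀ η' ∈ S.maxSing, η' ≠ η → Disjoint ((U : S.Y.Opens) : Set S.Y) (closure ({η'} : Set S.Y))) →
        ∀ n, (P.piece n).ideal U = ((R η).piece n).ideal U := by
  classical
  -- a default Rees algebra off `maxSing` (all pieces `𝒪_Y`)
  let R₀ : ReesAlgebraData S.Y :=
    { piece := fun _ => ⊤, piece_zero := rfl, piece_mul_le := fun _ _ => le_top }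
  have h' : ∀ η : S.Y, ∃ R : ReesAlgebraData S.Y, η ∈ S.maxSing →
      IsAdmissibleCentre S.f S.i.ker R ∧ R.support = closure ({η} : Set S.Y) ∧ Q η R := fun η => by
    by_cases hη : η ∈ S.maxSing
    · obtain ⟨R, hR⟩ := h η hη
      exact ⟨R, fun _ => hR⟩
    · exact ⟨R₀, fun h => absurd h hη⟩
  choose R hR using h'
  obtain ⟨P, hP⟩ := exists_reesAlgebraData_piece_eq_finsetProd S.maxSing_finite.toFinset R
  have hadm : ∀ η ∈ S.maxSing, IsAdmissibleCentre S.f S.i.ker (R η) := fun η hη => (hR η hη).1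
  have hsupp : ∀ η ∈ S.maxSing, (R η).support = closure ({η} : Set S.Y) := fun η hη => (hR η hη).2.1
  obtain ⟨hadmP, hsuppP⟩ :=
    S.isAdmissibleCentre_and_support_eq_singImage_of_piece_eq_finsetProd R hadm hsupp hdisj P hP
  exact ⟨R, P, fun η hη => hR η hη, hP, hadmP, hsuppP, fun η hη U hU n =>
    S.ideal_piece_eq_of_forall_disjoint R (fun η' hη' => (hadm η' hη').1) hsupp P hP hη U hU n⟩

/-- **Packaged existence under `Stage.Inv`** (disjointness from `pairwiseDisjoint_closure_maxSing`): the
`IsAdmissibleCentre ∧ support = singImage` clauses of `stub_e1_centre` from orbit-wise centres with a rider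
`Q`, together with the locality `P = R η` near `closure {η}` that transports the rider. [folklore] -/
theorem exists_isAdmissibleCentre_support_eq_singImage_of_inv_of_forall_exists (hInv : S.Inv)
    (Q : S.Y → ReesAlgebraData S.Y → Prop)
    (h : ∀ η ∈ S.maxSing, ∃ R : ReesAlgebraData S.Y,
      IsAdmissibleCentre S.f S.i.ker R ∧ R.support = closure ({η} : Set S.Y) ∧ Q η R) :
    ∃ (R : S.Y → ReesAlgebraData S.Y) (P : ReesAlgebraData S.Y),
      (∀ η ∈ S.maxSing,
        IsAdmissibleCentre S.f S.i.ker (R η) ∧ (R η).support = closure ({η} : Set S.Y) ∧ Q η (R η)) ∧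
      (∀ n, P.piece n = ∏ η ∈ S.maxSing_finite.toFinset, (R η).piece n) ∧
      IsAdmissibleCentre S.f S.i.ker P ∧ P.support = singImage S.i.ker ∧
      ∀ η ∈ S.maxSing, ∀ U : S.Y.affineOpens,
        (∀ η' ∈ S.maxSing, η' ≠ η → Disjoint ((U : S.Y.Opens) : Set S.Y) (closure ({η'} : Set S.Y))) →
        ∀ n, (P.piece n).ideal U = ((R η).piece n).ideal U :=
  S.exists_isAdmissibleCentre_support_eq_singImage_of_forall_exists
    (S.pairwiseDisjoint_closure_maxSing hInv) Q h

/-- **Packaged existence under the unit-chart form of (I2)** (disjointness from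
`pairwiseDisjoint_closure_of_unitCharts`). [folklore] -/
theorem exists_isAdmissibleCentre_support_eq_singImage_of_unitCharts_of_forall_exists
    (hI2w : ∀ a : S.atlas.ι,
      (∀ χ : Fin S.j → ℤ, ∃ s ∈ S.atlas.piece a (S.atlas.exponent • χ), IsUnit (S.i.app (S.atlas.W a) s)) →
      ∀ (η : S.Y) (_ : η ∈ S.maxSing) (hη : η ∈ (S.atlas.W a : S.Y.Opens)),
        letI := S.atlas.gradedRing a
        (((S.atlas.W a).2.primeIdealOf ⟨η, hη⟩).asIdeal).IsHomogeneous (S.atlas.piece a) ∧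
        ∀ (d : Fin S.j → ℤ) (x : Γ(S.Y, S.atlas.W a)), x ∈ S.atlas.piece a d →
          x ∉ ((S.atlas.W a).2.primeIdealOf ⟨η, hη⟩).asIdeal →
            IsUnit (Ideal.Quotient.mk ((S.atlas.W a).2.primeIdealOf ⟨η, hη⟩).asIdeal x))
    (Q : S.Y → ReesAlgebraData S.Y → Prop)
    (h : ∀ η ∈ S.maxSing, ∃ R : ReesAlgebraData S.Y,
      IsAdmissibleCentre S.f S.i.ker R ∧ R.support = closure ({η} : Set S.Y) ∧ Q η R) :
    ∃ (R : S.Y → ReesAlgebraData S.Y) (P : ReesAlgebraData S.Y),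
      (∀ η ∈ S.maxSing,
        IsAdmissibleCentre S.f S.i.ker (R η) ∧ (R η).support = closure ({η} : Set S.Y) ∧ Q η (R η)) ∧
      (∀ n, P.piece n = ∏ η ∈ S.maxSing_finite.toFinset, (R η).piece n) ∧
      IsAdmissibleCentre S.f S.i.ker P ∧ P.support = singImage S.i.ker ∧
      ∀ η ∈ S.maxSing, ∀ U : S.Y.affineOpens,
        (∀ η' ∈ S.maxSing, η' ≠ η → Disjoint ((U : S.Y.Opens) : Set S.Y) (closure ({η'} : Set S.Y))) →
        ∀ n, (P.piece n).ideal U = ((R η).piece n).ideal U :=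
  S.exists_isAdmissibleCentre_support_eq_singImage_of_forall_exists
    (S.pairwiseDisjoint_closure_of_unitCharts hI2w) Q h

end ELadderOne.Stage

end Summit.ResolutionOfSingularities.ResolutionOfSingularities.Theorems

end
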